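import Summits.BirchSwinnertonDyer.BirchSwinnertonDyer.Theorems.BiquadraticEisensteinDescentEisensteinHeartFlatCMInertBadKPrimeKatzHsiehDisplay
import Summits.BirchSwinnertonDyer.BirchSwinnertonDyer.Theorems.BiquadraticEisensteinDescentEisensteinHeartFlatCMInertBadKPrimeConstantScaling
import HarnessLib

set_option linter.dupNamespace false -- `Summit.BirchSwinnertonDyer.BirchSwinnertonDyer.Theorems.…` (summit = sub)
set_option autoImplicit false

/-!
# Crux `EisensteinHeartFlatCMInertBadKPrime` (stmt-BirchSwinnertonDyer-21341), line `hsieh-lambda` v3: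
# FRAME RIGIDITY of the input `stub_V4K` — any two admitted Katz base-change-line frames generate the same ideal up
# to non-zero constants, so the ♭-heart against ONE admitted frame is the ♭-heart against EVERY admitted frame

Route `BiquadraticEisensteinDescent` (cell `pub/bsd-wall`, lead seat `bsd-wall-cm-bed-p1` g3). THEOREMS ONLY (no definition,
no named fact, no `sorry`); supports stmt-BirchSwinnertonDyer-21341 as a helper; nothing about the crux's research input
(the Eisenstein divisibility itself) or about any case of BSD is asserted.

## Why this file exists (the lead's junk audit of the registered stub, skeleton v3 `cc08ae1089e5f3a0`)

The registered research stub `HsiehLambda.stub_V4K` (= the text the route pen is asked to promote to a crux child,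
`Cruxes/EisensteinHeartFlatCMInertBadKPrime/PromoteV4KCert.lean`) quantifies UNIVERSALLY over Katz base-change-line frames
`(L, Σ_p, S, T, λ, ϑ, C_K, Ω, Ω_p′, G, w₁, w₂, c_L, c_L′)` subject to the print-shaped ties (T) Katz type `k = 1`,
`κ_n = (n, n−1)` on Hsieh's range, (C) entire continuation, (L) `L(λ·χ∘N, 0) = c_L c_L′ⁿ L(f/K, χ, 1)`, (R) `λ` ramified on
`S ∪ {w ∣ p}` and on `Σ_p ∪ T`, (N) non-vanishing, and `KatzCM.IsBaseChangeLine … G`; its conclusion is the heart shape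
`∃ m, p^m · I ⊆ (G)` for an ideal `I` (the pushed `𝒪⟦T⟧`-characteristic ideal of the CM-side module `N`) that does NOT depend
on the frame. A statement of this shape is only as good as the rigidity of `G` across admitted frames: if two admitted
frames could carry series generating different ideals (beyond non-zero constants), the ∀-form would assert MORE than the
Eisenstein divisibility at the natural frame (and could even be junk-false). This file proves in the kernel that this does
not happen:

* §1 **`exists_span_C_mul_eq_of_frames`**: for ANY two admitted frames — over possibly DIFFERENT fields `L₁, L₂ ⊃ K`
  (each Galois over `K` with exactly two infinite places), with their own `Σ_p, S, T, λ, ϑ`, constants and periods — tied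
  to the same `(p, f)` (`p ∣ N`, `a_p(f) = 0`) along the same `(ι, κ, γ)`, the two Katz series satisfy
  `(C(c)·G₂) = (C(c′)·G₁)` for some `c, c′ ∈ 𝒪_{ℂ_p} ∖ 0`. Proof: the pointwise display relation
  `…KatzHsiehDisplay.display_relation` is a statement about the Katz display versus Hsieh's display FORMULA
  `hsiehInterpolationValue p f 𝔭 χ n A Ω_K C_H` for arbitrary non-zero `A, Ω_K, C_H, Ω_p` — no Hsieh WITNESS is needed —
  so Hsieh's formula (with `A = Ω_K = C_H = Ω_p = 1`, any finite prime `𝔭` of `K`) serves as a PIVOT: both Katz displays are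
  `(const)·(const)ⁿ·(power-multiplicative defect)(χ)` times the pivot, hence one is `c₀ c₁ⁿ δ(χ)` times the other, and the
  abstract rigidity `…KatzHsiehRigidity.exists_span_C_mul_eq_of_values_shape` (frames tied along the powers of a principal
  unit differ by a unit, after moving one constant) applies with `Q := G₁`.
* §2 **`heartShape_iff_of_frames`**: consequently, for every ideal `I` of `𝒪_{ℂ_p}⟦T⟧`,
  `(∃ m, p^m·I ⊆ (G₁)) ↔ (∃ m, p^m·I ⊆ (G₂))` (`…ConstantScaling.heartShape_iff_of_span_C_mul_eq`). Applied to
  `I :=` the pushed characteristic ideal of `stub_V4K`, this says: the conclusion of `stub_V4K` at ONE admitted frame (e.g. the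
  natural frame `L = K′(√d_CM)`, `Σ_p = {𝔓′}`, `λ = ψ_W∘N`, produced by the closed `stub_V2`) implies it at EVERY admitted
  frame for the same crux data — the promoted crux child is equivalent to the Eisenstein divisibility at the natural frame,
  and a future closer may work at a single frame of its choice.

References: [Hsieh2014mu] Prop. 4.9 (§4.8); [Hsieh2014] Thm. A (Doc. Math. 19 p. 712); [Castella2018] Thm. 3.1 (the frame
currency); [Washington1997] §5.1, §7.1.
-/

noncomputable section

open scoped Classical Topology NumberField
open Filter NumberField IsDedekindDomain Field PowerSeries Finset
open Literature.NumberTheory.EllipticCurves Literature.NumberTheory.GaloisRepresentations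
open Literature.NumberTheory.EllipticCurves.ModularForms

namespace Summit.BirchSwinnertonDyer.BirchSwinnertonDyer.Theorems.BiquadraticEisensteinDescentEisensteinHeartFlatCMInertBadKPrimeKatzFrameRigidity

open Summit.BirchSwinnertonDyer.BirchSwinnertonDyer.Theorems.BiquadraticEisensteinDescentEisensteinHeartFlatCMInertBadKPrimeKatzHsiehRigidity
open Summit.BirchSwinnertonDyer.BirchSwinnertonDyer.Theorems.BiquadraticEisensteinDescentEisensteinHeartFlatCMInertBadKPrimeKatzHsiehDisplay
open Summit.BirchSwinnertonDyer.BirchSwinnertonDyer.Theorems.BiquadraticEisensteinDescentEisensteinHeartFlatCMInertBadKPrimeConstantScaling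

variable {p : ℕ} [Fact p.Prime] {K : Type} [Field K] [NumberField K]
  {L₁ : Type} [Field L₁] [NumberField L₁] [Algebra K L₁] [IsGalois K L₁]
  {L₂ : Type} [Field L₂] [NumberField L₂] [Algebra K L₂] [IsGalois K L₂]

/-- A number field has a finite prime (`𝓞 K` is not a field). [folklore] -/
theorem nonempty_heightOneSpectrum (K : Type) [Field K] [NumberField K] : Nonempty (HeightOneSpectrum (𝓞 K)) := by
  obtain ⟨P, hP⟩ := Ideal.exists_maximal (𝓞 K)
  exact ⟨⟨P, hP.isPrime, Ring.ne_bot_of_isMaximal_of_not_isField hP (RingOfIntegers.not_isField K)⟩⟩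

/-- The scalar bookkeeping of the pivot: `(b₀/a₀)(b₁/a₁)ⁿ(d₂/d₁) · (a₀ a₁ⁿ d₁ X) = b₀ b₁ⁿ d₂ X`. [folklore] -/
theorem scalar_identity {F : Type*} [Field F] {a₀ a₁ d₁ : F} (b₀ b₁ d₂ X : F) (n : ℕ)
    (ha₀ : a₀ ≠ 0) (ha₁ : a₁ ≠ 0) (hd₁ : d₁ ≠ 0) :
    b₀ / a₀ * (b₁ / a₁) ^ n * (d₂ / d₁) * (a₀ * a₁ ^ n * d₁ * X) = b₀ * b₁ ^ n * d₂ * X := by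
  have e1 : a₀ / a₀ = 1 := div_self ha₀
  have e2 : a₁ / a₁ = 1 := div_self ha₁
  have e3 : d₁ / d₁ = 1 := div_self hd₁
  calc b₀ / a₀ * (b₁ / a₁) ^ n * (d₂ / d₁) * (a₀ * a₁ ^ n * d₁ * X)
      = (b₀ * b₁ ^ n * d₂ * X) * ((a₀ / a₀) * (a₁ / a₁) ^ n * (d₁ / d₁)) := by rw [div_pow, div_pow]; ring
    _ = b₀ * b₁ ^ n * d₂ * X := by rw [e1, e2, e3, one_pow, mul_one, mul_one, mul_one]

/-! ### §1 Two admitted frames generate the same ideal up to non-zero constants -/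

/-- **FRAME RIGIDITY for the Katz base-change-line frames of line `hsieh-lambda`.** Let `p` be odd, `K` imaginary
quadratic, `κ` anticyclotomic with topological generator `γ`, `f` of level `N` with `p ∣ N` and `a_p(f) = 0`. Let
`(L₁, Σ_{p,1}, S₁, T₁, λ₁, ϑ₁, C₁, Ω₁, Ω′_{p,1}, G₁)` and `(L₂, …, G₂)` be two Katz base-change-line frames
(`KatzCM.IsBaseChangeLine`, Hsieh Crelle 688 Prop. 4.9 read downstairs) over fields `L₁, L₂ ⊃ K` (Galois, exactly two
infinite places each), each satisfying the ties (T) Katz type `k = 1`, `κ_n = (n, n−1)` on Hsieh's range, (C) entire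
continuation, (L) `L(λᵢ·χ∘N, 0) = c_{L,i} c_{L,i}′ⁿ L(f/K, χ, 1)` with non-zero constants, (R) `λᵢ` ramified on
`Sᵢ ∪ {w ∣ p}` and on `Σ_{p,i} ∪ Tᵢ`, (N) non-vanishing of `Cᵢ, Ωᵢ, Im σ_w(ϑᵢ), Ω′_{p,i}`. Then
`(C(c)·G₂) = (C(c′)·G₁)` for some `c, c′ ∈ 𝒪_{ℂ_p} ∖ 0`. (Pivot through Hsieh's display formula with trivial constants;
then `exists_span_C_mul_eq_of_values_shape`.) [cite: Hsieh2014mu, Prop. 4.9 (§4.8)]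
[cite: Hsieh2014, Thm. A p. 712 (Doc. Math. 19)] [cite: Castella2018, Thm. 3.1 (arXiv:1704.06608 p. 9)] -/
theorem exists_span_C_mul_eq_of_frames {ι : PadicAlgCl p ≃+* ℂ} {κ : ZpExtension K p} {γ : absoluteGaloisGroup K}
    (hp2 : p ≠ 2) (hK : IsImaginaryQuadratic K) (hκ : κ.IsAnticyclotomic) (hγ : κ.IsTopGenerator γ)
    {N : ℕ} {f : CuspForm (CongruenceSubgroup.Gamma0 N) 2} (hpN : p ∣ N) (hap : cuspCoeff f p = 0)
    -- frame 1
    {Sp₁ S₁ T₁ : Finset (HeightOneSpectrum (𝓞 L₁))} {lam₁ : HeckeCharacter L₁} {ϑ₁ : L₁} {CK₁ : ℂ}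
    {Ω₁ : InfinitePlace L₁ → ℂ} {ΩpK₁ : InfinitePlace L₁ → ℂ_[p]} {G₁ : PowerSeries 𝓞_ℂ_[p]}
    (hG₁ : KatzCM.IsBaseChangeLine ι Sp₁ S₁ T₁ κ γ lam₁ ϑ₁ CK₁ Ω₁ ΩpK₁ G₁)
    {u₁ u₂ : InfinitePlace L₁} (hu : u₁ ≠ u₂) (huniv₁ : ∀ w : InfinitePlace L₁, w = u₁ ∨ w = u₂)
    (hT₁ : ∀ (χ : HeckeCharacter K) (n : ℕ), 0 < n → (∀ v : HeightOneSpectrum (𝓞 K), χ.IsUnramifiedAt v) →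
      χ.HasInfinityType (fun _ ↦ (n : ℤ)) (fun _ ↦ -(n : ℤ)) →
      KatzCM.HasKatzType ι Sp₁ (lam₁ * χ.compRelNorm L₁) 1 (fun w ↦ if w = u₁ then n else n - 1))
    (hcont₁ : ∀ (χ : HeckeCharacter K) (n : ℕ), 0 < n → (∀ v : HeightOneSpectrum (𝓞 K), χ.IsUnramifiedAt v) →
      χ.HasInfinityType (fun _ ↦ (n : ℤ)) (fun _ ↦ -(n : ℤ)) →
      LFunction.HasEntireContinuation (heckeLFunction (lam₁ * χ.compRelNorm L₁)))
    {cL₁ cL₁' : ℂ} (hcL₁ : cL₁ ≠ 0) (hcL₁' : cL₁' ≠ 0)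
    (hLval₁ : ∀ (χ : HeckeCharacter K) (n : ℕ), 0 < n → (∀ v : HeightOneSpectrum (𝓞 K), χ.IsUnramifiedAt v) →
      χ.HasInfinityType (fun _ ↦ (n : ℤ)) (fun _ ↦ -(n : ℤ)) →
      ∀ hL : LFunction.HasEntireContinuation (heckeLFunction (lam₁ * χ.compRelNorm L₁)),
        hL.continuation 0 = cL₁ * cL₁' ^ n * rankinSelbergValueHecke f χ 1)
    (hramS₁ : ∀ w ∈ S₁ ∪ KatzCM.primesOver L₁ p, ¬ lam₁.IsUnramifiedAt w)
    (hramT₁ : ∀ w ∈ Sp₁ ∪ T₁, ¬ lam₁.IsUnramifiedAt w)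
    (hCK₁ : CK₁ ≠ 0) (hΩ₁ : ∀ w, Ω₁ w ≠ 0) (hIm₁ : ∀ w, (KatzCM.embeddingAt ι Sp₁ w ϑ₁).im ≠ 0)
    (hΩpK₁ : ∀ w, ΩpK₁ w ≠ 0)
    -- frame 2
    {Sp₂ S₂ T₂ : Finset (HeightOneSpectrum (𝓞 L₂))} {lam₂ : HeckeCharacter L₂} {ϑ₂ : L₂} {CK₂ : ℂ}
    {Ω₂ : InfinitePlace L₂ → ℂ} {ΩpK₂ : InfinitePlace L₂ → ℂ_[p]} {G₂ : PowerSeries 𝓞_ℂ_[p]}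
    (hG₂ : KatzCM.IsBaseChangeLine ι Sp₂ S₂ T₂ κ γ lam₂ ϑ₂ CK₂ Ω₂ ΩpK₂ G₂)
    {v₁ v₂ : InfinitePlace L₂} (hv : v₁ ≠ v₂) (huniv₂ : ∀ w : InfinitePlace L₂, w = v₁ ∨ w = v₂)
    (hT₂ : ∀ (χ : HeckeCharacter K) (n : ℕ), 0 < n → (∀ v : HeightOneSpectrum (𝓞 K), χ.IsUnramifiedAt v) →
      χ.HasInfinityType (fun _ ↦ (n : ℤ)) (fun _ ↦ -(n : ℤ)) →
      KatzCM.HasKatzType ι Sp₂ (lam₂ * χ.compRelNorm L₂) 1 (fun w ↦ if w = v₁ then n else n - 1))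
    (hcont₂ : ∀ (χ : HeckeCharacter K) (n : ℕ), 0 < n → (∀ v : HeightOneSpectrum (𝓞 K), χ.IsUnramifiedAt v) →
      χ.HasInfinityType (fun _ ↦ (n : ℤ)) (fun _ ↦ -(n : ℤ)) →
      LFunction.HasEntireContinuation (heckeLFunction (lam₂ * χ.compRelNorm L₂)))
    {cL₂ cL₂' : ℂ} (hcL₂ : cL₂ ≠ 0) (hcL₂' : cL₂' ≠ 0)
    (hLval₂ : ∀ (χ : HeckeCharacter K) (n : ℕ), 0 < n → (∀ v : HeightOneSpectrum (𝓞 K), χ.IsUnramifiedAt v) →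
      χ.HasInfinityType (fun _ ↦ (n : ℤ)) (fun _ ↦ -(n : ℤ)) →
      ∀ hL : LFunction.HasEntireContinuation (heckeLFunction (lam₂ * χ.compRelNorm L₂)),
        hL.continuation 0 = cL₂ * cL₂' ^ n * rankinSelbergValueHecke f χ 1)
    (hramS₂ : ∀ w ∈ S₂ ∪ KatzCM.primesOver L₂ p, ¬ lam₂.IsUnramifiedAt w)
    (hramT₂ : ∀ w ∈ Sp₂ ∪ T₂, ¬ lam₂.IsUnramifiedAt w)
    (hCK₂ : CK₂ ≠ 0) (hΩ₂ : ∀ w, Ω₂ w ≠ 0) (hIm₂ : ∀ w, (KatzCM.embeddingAt ι Sp₂ w ϑ₂).im ≠ 0)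
    (hΩpK₂ : ∀ w, ΩpK₂ w ≠ 0) :
    ∃ c c' : 𝓞_ℂ_[p], c ≠ 0 ∧ c' ≠ 0 ∧
      Ideal.span ({C c * G₂} : Set (PowerSeries 𝓞_ℂ_[p])) = Ideal.span {C c' * G₁} := by
  -- a finite prime of `K` for the pivot display (any will do)
  obtain ⟨𝔭⟩ := nonempty_heightOneSpectrum K
  have h1ℝ : (1 : ℝ) ≠ 0 := one_ne_zero
  have h1ℂ : (1 : ℂ) ≠ 0 := one_ne_zero
  have h1p : (1 : ℂ_[p]) ≠ 0 := one_ne_zero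
  -- both Katz displays against the SAME pivot: Hsieh's display formula with trivial constants
  obtain ⟨a₀, a₁, δ₁, ha₀, ha₁, hδ₁0, hδ₁pow, hdisp₁⟩ :=
    display_relation (𝔭 := 𝔭) (A := (1 : ℝ)) (ΩK := (1 : ℂ)) (CH := (1 : ℂ)) (Ωp := (1 : ℂ_[p]))
      hu huniv₁ hT₁ hcont₁ hcL₁ hcL₁' hLval₁ hpN hap hramS₁ hramT₁ hCK₁ hΩ₁ hIm₁ hΩpK₁ h1ℝ h1ℂ h1ℂ h1p
  obtain ⟨b₀, b₁, δ₂, hb₀, hb₁, hδ₂0, hδ₂pow, hdisp₂⟩ :=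
    display_relation (𝔭 := 𝔭) (A := (1 : ℝ)) (ΩK := (1 : ℂ)) (CH := (1 : ℂ)) (Ωp := (1 : ℂ_[p]))
      hv huniv₂ hT₂ hcont₂ hcL₂ hcL₂' hLval₂ hpN hap hramS₂ hramT₂ hCK₂ hΩ₂ hIm₂ hΩpK₂ h1ℝ h1ℂ h1ℂ h1p
  -- the abstract rigidity with `Q := G₁` (values `F χ n := a₀ a₁ⁿ δ₁(χ) · pivot`) and `G := G₂`
  -- (values `(b₀/a₀) (b₁/a₁)ⁿ (δ₂/δ₁)(χ) · F χ n`)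
  refine exists_span_C_mul_eq_of_values_shape (ι := ι) hp2 hK hκ hγ
    (F := fun χ n ↦ a₀ * a₁ ^ n * δ₁ χ *
      ((((ι.symm (hsiehInterpolationValue p f 𝔭 χ n (1 : ℝ) (1 : ℂ) (1 : ℂ))) : PadicAlgCl p) : ℂ_[p]) *
        (1 : ℂ_[p]) ^ (4 * n)))
    (Q := G₁) (G := G₂) ?_ (c₀ := b₀ / a₀) (c₁ := b₁ / a₁) (div_ne_zero hb₀ ha₀) (div_ne_zero hb₁ ha₁)
    (δ := fun χ ↦ δ₂ χ / δ₁ χ) (fun χ ↦ div_ne_zero (hδ₂0 χ) (hδ₁0 χ)) ?_ ?_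
  · -- `G₁` has the values `F χ n` on the range
    intro χ n hn hunr hinf r hr hf
    obtain ⟨k, κ_, hL, hk, hKT, heq⟩ := hdisp₁ χ n hn hunr hinf
    have h := hG₁.hasValueAt hr hf hk hKT hunr hL
    rw [heq] at h
    exact h
  · -- the defect ratio is power-multiplicative
    intro χ k
    simp only [hδ₁pow, hδ₂pow, div_pow]
  · -- `G₂` has the values `c₀ c₁ⁿ δ(χ) F χ n` on the range
    intro χ n hn hunr hinf r hr hf
    obtain ⟨k, κ_, hL, hk, hKT, heq⟩ := hdisp₂ χ n hn hunr hinf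
    have h := hG₂.hasValueAt hr hf hk hKT hunr hL
    rw [heq] at h
    convert h using 1
    exact scalar_identity _ _ _ _ n ha₀ ha₁ (hδ₁0 χ)

/-! ### §2 The ♭-heart's conclusion does not depend on the admitted frame -/

/-- **The heart shape is frame-independent.** Under the hypotheses of `exists_span_C_mul_eq_of_frames`, for every
ideal `I` of `𝒪_{ℂ_p}⟦T⟧`: `(∃ m, ∀ x ∈ I, C(p)^m·x ∈ (G₁)) ↔ (∃ m, ∀ x ∈ I, C(p)^m·x ∈ (G₂))`. With `I :=` the pushed
`𝒪⟦T⟧`-characteristic ideal of the CM-side module `N` of `HsiehLambda.stub_V4K` (which does not depend on the frame),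
the registered stub at ONE admitted frame implies it at EVERY admitted frame for the same crux data.
[cite: Hsieh2014mu, Prop. 4.9 (§4.8)] [cite: Castella2018, Thm. 3.1 (arXiv:1704.06608 p. 9)] -/
theorem heartShape_iff_of_frames {ι : PadicAlgCl p ≃+* ℂ} {κ : ZpExtension K p} {γ : absoluteGaloisGroup K}
    (hp2 : p ≠ 2) (hK : IsImaginaryQuadratic K) (hκ : κ.IsAnticyclotomic) (hγ : κ.IsTopGenerator γ)
    {N : ℕ} {f : CuspForm (CongruenceSubgroup.Gamma0 N) 2} (hpN : p ∣ N) (hap : cuspCoeff f p = 0)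
    -- frame 1
    {Sp₁ S₁ T₁ : Finset (HeightOneSpectrum (𝓞 L₁))} {lam₁ : HeckeCharacter L₁} {ϑ₁ : L₁} {CK₁ : ℂ}
    {Ω₁ : InfinitePlace L₁ → ℂ} {ΩpK₁ : InfinitePlace L₁ → ℂ_[p]} {G₁ : PowerSeries 𝓞_ℂ_[p]}
    (hG₁ : KatzCM.IsBaseChangeLine ι Sp₁ S₁ T₁ κ γ lam₁ ϑ₁ CK₁ Ω₁ ΩpK₁ G₁)
    {u₁ u₂ : InfinitePlace L₁} (hu : u₁ ≠ u₂) (huniv₁ : ∀ w : InfinitePlace L₁, w = u₁ ∨ w = u₂)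
    (hT₁ : ∀ (χ : HeckeCharacter K) (n : ℕ), 0 < n → (∀ v : HeightOneSpectrum (𝓞 K), χ.IsUnramifiedAt v) →
      χ.HasInfinityType (fun _ ↦ (n : ℤ)) (fun _ ↦ -(n : ℤ)) →
      KatzCM.HasKatzType ι Sp₁ (lam₁ * χ.compRelNorm L₁) 1 (fun w ↦ if w = u₁ then n else n - 1))
    (hcont₁ : ∀ (χ : HeckeCharacter K) (n : ℕ), 0 < n → (∀ v : HeightOneSpectrum (𝓞 K), χ.IsUnramifiedAt v) →
      χ.HasInfinityType (fun _ ↦ (n : ℤ)) (fun _ ↦ -(n : ℤ)) →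
      LFunction.HasEntireContinuation (heckeLFunction (lam₁ * χ.compRelNorm L₁)))
    {cL₁ cL₁' : ℂ} (hcL₁ : cL₁ ≠ 0) (hcL₁' : cL₁' ≠ 0)
    (hLval₁ : ∀ (χ : HeckeCharacter K) (n : ℕ), 0 < n → (∀ v : HeightOneSpectrum (𝓞 K), χ.IsUnramifiedAt v) →
      χ.HasInfinityType (fun _ ↦ (n : ℤ)) (fun _ ↦ -(n : ℤ)) →
      ∀ hL : LFunction.HasEntireContinuation (heckeLFunction (lam₁ * χ.compRelNorm L₁)),
        hL.continuation 0 = cL₁ * cL₁' ^ n * rankinSelbergValueHecke f χ 1)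
    (hramS₁ : ∀ w ∈ S₁ ∪ KatzCM.primesOver L₁ p, ¬ lam₁.IsUnramifiedAt w)
    (hramT₁ : ∀ w ∈ Sp₁ ∪ T₁, ¬ lam₁.IsUnramifiedAt w)
    (hCK₁ : CK₁ ≠ 0) (hΩ₁ : ∀ w, Ω₁ w ≠ 0) (hIm₁ : ∀ w, (KatzCM.embeddingAt ι Sp₁ w ϑ₁).im ≠ 0)
    (hΩpK₁ : ∀ w, ΩpK₁ w ≠ 0)
    -- frame 2
    {Sp₂ S₂ T₂ : Finset (HeightOneSpectrum (𝓞 L₂))} {lam₂ : HeckeCharacter L₂} {ϑ₂ : L₂} {CK₂ : ℂ}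
    {Ω₂ : InfinitePlace L₂ → ℂ} {ΩpK₂ : InfinitePlace L₂ → ℂ_[p]} {G₂ : PowerSeries 𝓞_ℂ_[p]}
    (hG₂ : KatzCM.IsBaseChangeLine ι Sp₂ S₂ T₂ κ γ lam₂ ϑ₂ CK₂ Ω₂ ΩpK₂ G₂)
    {v₁ v₂ : InfinitePlace L₂} (hv : v₁ ≠ v₂) (huniv₂ : ∀ w : InfinitePlace L₂, w = v₁ ∨ w = v₂)
    (hT₂ : ∀ (χ : HeckeCharacter K) (n : ℕ), 0 < n → (∀ v : HeightOneSpectrum (𝓞 K), χ.IsUnramifiedAt v) →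
      χ.HasInfinityType (fun _ ↦ (n : ℤ)) (fun _ ↦ -(n : ℤ)) →
      KatzCM.HasKatzType ι Sp₂ (lam₂ * χ.compRelNorm L₂) 1 (fun w ↦ if w = v₁ then n else n - 1))
    (hcont₂ : ∀ (χ : HeckeCharacter K) (n : ℕ), 0 < n → (∀ v : HeightOneSpectrum (𝓞 K), χ.IsUnramifiedAt v) →
      χ.HasInfinityType (fun _ ↦ (n : ℤ)) (fun _ ↦ -(n : ℤ)) →
      LFunction.HasEntireContinuation (heckeLFunction (lam₂ * χ.compRelNorm L₂)))
    {cL₂ cL₂' : ℂ} (hcL₂ : cL₂ ≠ 0) (hcL₂' : cL₂' ≠ 0)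
    (hLval₂ : ∀ (χ : HeckeCharacter K) (n : ℕ), 0 < n → (∀ v : HeightOneSpectrum (𝓞 K), χ.IsUnramifiedAt v) →
      χ.HasInfinityType (fun _ ↦ (n : ℤ)) (fun _ ↦ -(n : ℤ)) →
      ∀ hL : LFunction.HasEntireContinuation (heckeLFunction (lam₂ * χ.compRelNorm L₂)),
        hL.continuation 0 = cL₂ * cL₂' ^ n * rankinSelbergValueHecke f χ 1)
    (hramS₂ : ∀ w ∈ S₂ ∪ KatzCM.primesOver L₂ p, ¬ lam₂.IsUnramifiedAt w)
    (hramT₂ : ∀ w ∈ Sp₂ ∪ T₂, ¬ lam₂.IsUnramifiedAt w)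
    (hCK₂ : CK₂ ≠ 0) (hΩ₂ : ∀ w, Ω₂ w ≠ 0) (hIm₂ : ∀ w, (KatzCM.embeddingAt ι Sp₂ w ϑ₂).im ≠ 0)
    (hΩpK₂ : ∀ w, ΩpK₂ w ≠ 0)
    (I : Ideal (PowerSeries 𝓞_ℂ_[p])) :
    (∃ m : ℕ, ∀ x ∈ I, (C ((p : ℕ) : 𝓞_ℂ_[p]) : PowerSeries 𝓞_ℂ_[p]) ^ m * x ∈ Ideal.span {G₁}) ↔
      (∃ m : ℕ, ∀ x ∈ I, (C ((p : ℕ) : 𝓞_ℂ_[p]) : PowerSeries 𝓞_ℂ_[p]) ^ m * x ∈ Ideal.span {G₂}) := by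
  obtain ⟨c, c', hc, hc', h⟩ :=
    exists_span_C_mul_eq_of_frames hp2 hK hκ hγ hpN hap hG₁ hu huniv₁ hT₁ hcont₁ hcL₁ hcL₁' hLval₁ hramS₁ hramT₁
      hCK₁ hΩ₁ hIm₁ hΩpK₁ hG₂ hv huniv₂ hT₂ hcont₂ hcL₂ hcL₂' hLval₂ hramS₂ hramT₂ hCK₂ hΩ₂ hIm₂ hΩpK₂
  exact (heartShape_iff_of_span_C_mul_eq hc hc' h I).symm

end Summit.BirchSwinnertonDyer.BirchSwinnertonDyer.Theorems.BiquadraticEisensteinDescentEisensteinHeartFlatCMInertBadKPrimeKatzFrameRigidity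

end
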